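import Mathlib.Algebra.TrivSqZeroExt.Basic
import Mathlib.RingTheory.Nilpotent.Basic
import Mathlib.RingTheory.Nilpotent.Lemmas
import Mathlib.Algebra.MvPolynomial.PDeriv
import Mathlib.Algebra.Polynomial.Taylor
import Mathlib.Algebra.Polynomial.Identities
import Mathlib.Algebra.Polynomial.AlgebraMap
import Mathlib.Algebra.Polynomial.Div
import Mathlib.RingTheory.Ideal.Operations
import Mathlib.RingTheory.Ideal.Span
import HarnessLib

/-!
# Square-zero jets: Newton's lemma in nilpotent rings and the first-order Taylor formula in `A[ε]`

Topic: `Literature/AlgebraicGeometry/Resolution`. Elementary commutative algebra used to build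
"test points" of polynomial rings in local Artinian rings — ring homomorphisms
`k[X₁,…,Xₙ] → A[ε] = A ⊕ Aε` (`TrivSqZeroExt A A`) through which membership questions
`a ∈ b·S` in a localization `S` of `k[X]` are refuted (if `Θ(b) = 0`, `Θ(a) ≠ 0` and `Θ` inverts the
denominators, then `a ∉ bS`). First consumer: the Sally–Shannon barrier
`Literature/Barriers/ResolutionOfSingularities/LocalFactorizationFailsDimThree.lean` (local
factorization of birational maps fails in dimension three), where the test points are jets of a
surface germ.

## Content (namespace `Literature.AlgebraicGeometry.Resolution`; everything PROVED, all [folklore])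

* `exists_isNilpotent_isRoot_of_coeff` — **Newton's lemma in the nilpotent setting**: a polynomial
  `P ∈ D[Z]` with `P(0)` nilpotent and `P'(0) = coeff₁ P` a unit has a root in the ideal `(P(0))`
  (Newton iteration doubles the `(P(0))`-adic order; no completeness or Henselian hypothesis).
* `fst_aeval_tsze`, `snd_aeval_tsze` — **first-order Taylor expansion** of `p ∈ S[X_σ]` at a point
  `θ` of `A[ε]`: `fst p(θ) = p(fst θ)` and `snd p(θ) = Σᵢ snd θᵢ · (∂p/∂Xᵢ)(fst θ)`.
* `snd_polynomial_aeval_inr_one` — `q(ε) = q₀ + q₁ε` for `q ∈ D[Z]`.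
* `eval_mvPolynomial_aeval` — `(p(f))(z) = p(f(z))` for `f : σ → D[Z]`.
* `isNilpotent_inr`, `isNilpotent_inl`, `isNilpotent_inl_add_inr`, `isUnit_algebraMap_add` —
  nilpotents and units of `A[ε]`.

## Sources

Standard (Newton–Hensel iteration; dual numbers and derivations, e.g. Matsumura, *Commutative Ring
Theory*, §25). [folklore]
-/

noncomputable section

namespace Literature.AlgebraicGeometry.Resolution

open _root_.MvPolynomial _root_.TrivSqZeroExt

/-! ### Newton's lemma in nilpotent rings -/

/-- **Newton's lemma in the nilpotent setting**: a polynomial `P` over a commutative ring whose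
constant coefficient is nilpotent and whose linear coefficient is a unit has a root in the ideal
generated by `P(0)` (Newton iteration `a ↦ a − P(a)/P'(a)` doubles the order of `P(a)` in the
nilpotent ideal `(P(0))`). [folklore] -/
theorem exists_isNilpotent_isRoot_of_coeff {D : Type*} [CommRing D] (P : Polynomial D)
    (h0 : IsNilpotent (P.coeff 0)) (h1 : IsUnit (P.coeff 1)) :
    ∃ a ∈ Ideal.span {P.coeff 0}, P.IsRoot a := by
  set c := P.coeff 0 with hc
  set I : Ideal D := Ideal.span {c} with hI
  -- every element of `I` is nilpotent
  have hInil : ∀ x ∈ I, IsNilpotent x := by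
    intro x hx
    obtain ⟨s, rfl⟩ := Ideal.mem_span_singleton'.mp hx
    exact Commute.isNilpotent_mul_left (Commute.all _ _) h0
  -- the derivative is a unit at every point of `I`
  have hder : ∀ a ∈ I, IsUnit (P.derivative.eval a) := by
    intro a ha
    have h10 : P.derivative.eval 0 = P.coeff 1 := by
      rw [← Polynomial.coeff_zero_eq_eval_zero, Polynomial.coeff_derivative]; simp
    obtain ⟨r, hr⟩ := Polynomial.sub_dvd_eval_sub a 0 P.derivative
    have hsplit : P.derivative.eval a = P.coeff 1 + (a - 0) * r := by rw [← hr, h10]; ring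
    rw [hsplit]
    refine IsNilpotent.isUnit_add_left_of_commute ?_ h1 (Commute.all _ _)
    rw [sub_zero]
    exact Commute.isNilpotent_mul_right (Commute.all _ _) (hInil a ha)
  -- Newton iteration: `P(a) ∈ I ^ (m + 1)` is attainable for every `m`
  have step : ∀ m : ℕ, ∃ a ∈ I, P.eval a ∈ I ^ (m + 1) := by
    intro m
    induction m with
    | zero =>
      exact ⟨0, I.zero_mem, by
        rw [zero_add, pow_one, ← Polynomial.coeff_zero_eq_eval_zero]; exact Ideal.subset_span rfl⟩
    | succ m ih =>
      obtain ⟨a, haI, hPa⟩ := ih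
      obtain ⟨w, hw⟩ := hder a haI
      set y : D := -(P.eval a * ↑w⁻¹) with hy
      refine ⟨a + y, ?_, ?_⟩
      · refine I.add_mem haI (I.neg_mem (I.mul_mem_right _ ?_))
        exact Ideal.pow_le_self (Nat.succ_ne_zero m) hPa
      · obtain ⟨q, hq⟩ := Polynomial.binomExpansion P a y
        have hval : P.eval (a + y) = q * y ^ 2 := by
          rw [hq, ← hw, hy]
          have : (w : D) * -(P.eval a * ↑w⁻¹) = -P.eval a := by
            rw [mul_neg, mul_comm, mul_assoc, Units.inv_mul, mul_one]
          rw [this]; ring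
        rw [hval, hy, neg_sq, mul_pow]
        refine Ideal.mul_mem_left _ _ (Ideal.mul_mem_right _ _ ?_)
        have h2 : P.eval a ^ 2 ∈ I ^ (m + 1 + (m + 1)) := by
          rw [pow_two, pow_add]; exact Ideal.mul_mem_mul hPa hPa
        exact Ideal.pow_le_pow_right (by omega) h2
  obtain ⟨n, hn⟩ := h0
  obtain ⟨a, haI, hPa⟩ := step n
  refine ⟨a, haI, ?_⟩
  have hIn : I ^ n = ⊥ := by
    rw [hI, Ideal.span_singleton_pow, hn, Ideal.span_singleton_eq_bot]
  have : P.eval a ∈ I ^ n := Ideal.pow_le_pow_right (Nat.le_succ n) hPa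
  rw [hIn, Ideal.mem_bot] at this
  exact this


/-! ### First-order Taylor expansion in `A[ε]` -/

section Taylor

variable {S : Type*} [CommRing S] {A : Type*} [CommRing A] [Algebra S A]

/-- First-order Taylor expansion in the square-zero extension `A[ε] = A ⊕ Aε`, constant part:
`fst (p(θ)) = p(fst θ)`. [folklore] -/
theorem fst_aeval_tsze {σ : Type*} (θ : σ → TrivSqZeroExt A A) (p : MvPolynomial σ S) :
    (aeval θ p).fst = aeval (fun i => (θ i).fst) p := by
  change (fstHom S A A) (aeval θ p) = _
  rw [← AlgHom.comp_apply, comp_aeval]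
  rfl

/-- First-order Taylor expansion in the square-zero extension `A[ε] = A ⊕ Aε`, `ε`-part:
`snd (p(θ)) = Σᵢ snd θᵢ · (∂p/∂Xᵢ)(fst θ)`. [folklore] -/
theorem snd_aeval_tsze {σ : Type*} [Fintype σ] [DecidableEq σ] (θ : σ → TrivSqZeroExt A A)
    (p : MvPolynomial σ S) :
    (aeval θ p).snd = ∑ i, (θ i).snd * aeval (fun i => (θ i).fst) (pderiv i p) := by
  induction p using MvPolynomial.induction_on with
  | C a =>
    simp only [algHom_C, algebraMap_eq_inl', snd_inl, pderiv_C, map_zero, mul_zero,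
      Finset.sum_const_zero]
  | add p q hp hq =>
    simp only [map_add, snd_add, hp, hq, mul_add, Finset.sum_add_distrib]
  | mul_X p n hp =>
    have hfst := fst_aeval_tsze θ p
    simp only [map_mul, aeval_X, snd_mul, smul_eq_mul, MulOpposite.smul_eq_mul_unop,
      MulOpposite.unop_op, hp, hfst, Derivation.leibniz, pderiv_X, smul_eq_mul, map_add,
      map_mul, aeval_X, mul_add, Finset.sum_add_distrib]
    have h1 : ∑ i, (θ i).snd * (aeval (fun i => (θ i).fst) p * aeval (fun i => (θ i).fst)
        ((Pi.single i 1 : σ → MvPolynomial σ S) n)) = aeval (fun i => (θ i).fst) p * (θ n).snd := by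
      have : ∀ i, aeval (fun i => (θ i).fst) ((Pi.single i 1 : σ → MvPolynomial σ S) n) =
          if n = i then 1 else 0 := by
        intro i
        by_cases h : n = i
        · subst h; simp
        · simp [h]
      simp_rw [this, mul_ite, mul_one, mul_zero]
      rw [Finset.sum_ite_eq Finset.univ n]
      simp [mul_comm]
    rw [h1]
    have h2 : ∑ i, (θ i).snd * ((θ n).fst * aeval (fun i => (θ i).fst) ((pderiv i) p)) =
        (θ n).fst * ∑ i, (θ i).snd * aeval (fun i => (θ i).fst) ((pderiv i) p) := by
      rw [Finset.mul_sum]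
      refine Finset.sum_congr rfl fun i _ => by ring
    rw [h2]
    ring

end Taylor

/-! ### Square-zero coefficients -/

section Eps

variable {D : Type*} [CommRing D]

open _root_.TrivSqZeroExt

/-- `mε` is nilpotent (`ε² = 0`). [folklore] -/
theorem isNilpotent_inr (m : D) : IsNilpotent (inr m : TrivSqZeroExt D D) :=
  ⟨2, by rw [sq, inr_mul_inr]⟩

/-- `inl` preserves nilpotency. [folklore] -/
theorem isNilpotent_inl {m : D} (hm : IsNilpotent m) : IsNilpotent (inl m : TrivSqZeroExt D D) := by
  obtain ⟨n, hn⟩ := hm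
  refine ⟨n, ?_⟩
  change (inlHom D D m) ^ n = 0
  rw [← map_pow, hn, map_zero]

/-- `m + m'ε` is nilpotent when `m` is. [folklore] -/
theorem isNilpotent_inl_add_inr {m : D} (hm : IsNilpotent m) (m' : D) :
    IsNilpotent (inl m + inr m' : TrivSqZeroExt D D) :=
  Commute.isNilpotent_add (Commute.all _ _) (isNilpotent_inl hm) (isNilpotent_inr m')

/-- `q(ε) = q₀ + q₁ ε` in `D[ε]`: the `ε`-part is the linear coefficient of `q`. [folklore] -/
theorem snd_polynomial_aeval_inr_one (q : Polynomial D) :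
    (Polynomial.aeval (inr (1 : D) : TrivSqZeroExt D D) q).snd = q.coeff 1 := by
  have hfst : ∀ r : Polynomial D,
      (Polynomial.aeval (inr (1 : D) : TrivSqZeroExt D D) r).fst = r.coeff 0 := by
    intro r
    have : (fstHom D D D).comp (Polynomial.aeval (inr (1 : D) : TrivSqZeroExt D D)) =
        Polynomial.aeval (0 : D) := by
      refine Polynomial.algHom_ext ?_
      simp
    have h := congrArg (fun φ => φ r) this
    simp only [AlgHom.comp_apply, Polynomial.coe_aeval_eq_eval] at h
    change (Polynomial.aeval (inr (1:D) : TrivSqZeroExt D D) r).fst = _ at h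
    rw [h, Polynomial.coeff_zero_eq_eval_zero]
  conv_lhs => rw [← Polynomial.divX_mul_X_add q]
  rw [map_add, map_mul, Polynomial.aeval_X, Polynomial.aeval_C, snd_add, snd_mul,
    algebraMap_eq_inl, snd_inl, fst_inr, snd_inr]
  simp [hfst, Polynomial.coeff_divX]

end Eps

section Generic

variable {k : Type*} [Field k] {D : Type*} [CommRing D] [Algebra k D]

/-- A nonzero scalar plus a nilpotent element is a unit. [folklore] -/
theorem isUnit_algebraMap_add {c : k} (hc : c ≠ 0) {m : D} (hm : IsNilpotent m) :
    IsUnit (algebraMap k D c + m) :=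
  hm.isUnit_add_left_of_commute ((IsUnit.mk0 _ hc).map _) (Commute.all _ _)

/-- Evaluating a polynomial-valued evaluation: `(p(f))(z) = p(f(z))`. [folklore] -/
theorem eval_mvPolynomial_aeval {σ : Type*} (f : σ → Polynomial D) (z : D) (p : MvPolynomial σ k) :
    (aeval f p).eval z = aeval (fun i => (f i).eval z) p := by
  have : ((Polynomial.aeval z).restrictScalars k).comp (aeval f) =
      aeval (fun i => (f i).eval z) := by
    refine algHom_ext fun i => ?_
    simp [Polynomial.coe_aeval_eq_eval]
  have h := congrArg (fun φ => φ p) this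
  simpa [Polynomial.coe_aeval_eq_eval] using h

end Generic

end Literature.AlgebraicGeometry.Resolution

end
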